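import Mathlib.Data.ZMod.Basic
import Mathlib.Data.Finset.Card
import Mathlib.Tactic.Group
import Mathlib.Tactic.LinearCombination

/-!
# ω-census, family (b3): centre of index `6` — coordinates, the commutator subgroup `K = {1, c, c²}`, and cell words

HONEST FRAMING (pub-omega census; verbatim): lottery ticket; floor = certified bounds/negative ranges.
Census BOOKKEEPING (prereg P-028 of the cell, item .3): the algebraic half of a certified NEGATIVE RANGE for single TPP triples with
two `3`-sets in the groups with centre of index `6`; nothing here is progress on `ω`.  Used by `CentreIndexSixTPP.lean`.

THE CLASS.  `[G : Z(G)] = 6` means `G/Z(G) ≅ S₃`; then (the Schur multiplier of `S₃` is trivial) `G' = ⟨c⟩ ≅ C₃` meets `Z(G)`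
trivially, `C_G(c) = Z(G) × ⟨c⟩` is abelian of index `2`, an element outside it inverts `c` and has central square, so
`G = ⟨c⟩ ⋊ C` with `C = Z(G) ∪ τZ(G)` abelian: every element is `c^k γ` (`γ ∈ C`) and `(c^k γ)(c^{k'} γ') = c^{k + ε(γ) k'} γγ'`.
We work with the two coordinates this provides, as the hypothesis package `Coord c κ ε`: `c³ = 1`, `κ c = 1`,
`κ(gh) = κ g + ε(g) κ h` for a multiplicative sign `ε : G → {±1} ⊆ ZMod 3`, and all commutators in `K = {1, c, c²}` — satisfied
exactly by the groups `C₃ ⋊_ε C` with `C` abelian (every group whose centre has index `6`; also `C₃ × C`).  Instances (`S₃`, `Dic₃`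
by `decide`, `Q × A` by `Coord.prod`) are in `CentreIndexSixTPP.lean`.
CONTENTS: the algebra of `κ, ε` (`κ 1 = 0`, `κ(g⁻¹) = −ε g κ g`, `ε c = 1`, `κ(c²) = −1`), closure of `K` under products, inverses
and conjugation, `κ` injective on `K`; for cells `P = (x, y, w)`: `key P · (key P')⁻¹ = E(P, P') · k` with `k ∈ K`
(`key P = x y w`, `E` the TPP word), hence two cells of one coset fibre `{P : g⁻¹ key P ∈ K}` have `E(P, P') ∈ K`; and the
FIBRE WORD FORMULA `κ(E(P, P')) = ε_y ε_w (λ_P − λ_{P'} + ε_{y'} ε_{w'} B)` with the normalised lift `λ_P = ε_y ε_w κ_x` and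
`B = κ_y − ε_y ε_{y'} κ_{y'} + ε_y ε_{y'} (κ_w − ε_w ε_{w'} κ_{w'})` — the mechanism (M1) pre-registered in P-028.
Elementary new mathematics of the cell (pub-omega stpp-1 gen 12/13), not a published statement: it lives under `Summits/`.
-/

open Finset

namespace Summit.MatrixMultiplication.OmegaCensus.CentreIndexSix

/-- Three elements cover a set of size `≤ 3` containing a given one. [folklore] -/
theorem exists_cover_three {α : Type*} [DecidableEq α] {T : Finset α} (hT : #T ≤ 3) {e : α} (he : e ∈ T) :
    ∃ a b : α, ∀ y ∈ T, y = e ∨ y = a ∨ y = b := by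
  have hR : #(T.erase e) ≤ 2 := by rw [card_erase_of_mem he]; omega
  rcases (T.erase e).eq_empty_or_nonempty with h0 | ⟨a, ha⟩
  · refine ⟨e, e, fun y hy => Or.inl ?_⟩
    by_contra hne
    have := mem_erase.2 ⟨hne, hy⟩
    rw [h0] at this
    simp at this
  · have hR' : #((T.erase e).erase a) ≤ 1 := by rw [card_erase_of_mem ha]; omega
    rcases ((T.erase e).erase a).eq_empty_or_nonempty with h1 | ⟨b, hb⟩
    · refine ⟨a, a, fun y hy => ?_⟩
      by_cases hye : y = e
      · exact Or.inl hye
      by_cases hya : y = a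
      · exact Or.inr (Or.inl hya)
      have := mem_erase.2 ⟨hya, mem_erase.2 ⟨hye, hy⟩⟩
      rw [h1] at this
      simp at this
    · refine ⟨a, b, fun y hy => ?_⟩
      by_cases hye : y = e
      · exact Or.inl hye
      by_cases hya : y = a
      · exact Or.inr (Or.inl hya)
      exact Or.inr (Or.inr (card_le_one.1 hR' y (mem_erase.2 ⟨hya, mem_erase.2 ⟨hye, hy⟩⟩) b hb))

/-! ## Part B.  Groups with centre of index `6`, in coordinates

`[G : Z(G)] = 6` means `G/Z(G) ≅ S₃`, and then (Schur multiplier of `S₃` trivial) `G' = ⟨c⟩ ≅ C₃`, `C_G(c) = Z(G) × ⟨c⟩` is abelian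
of index `2`, every element outside it inverts `c` and has central square, so `G = ⟨c⟩ ⋊ C` with `C` abelian: every element is
`c^k γ` and `(c^k γ)(c^{k'} γ') = c^{k + ε(γ) k'} γ γ'`.  We work with the two coordinates this provides — the hypothesis
package `Coord c κ ε` below (discharged for `S₃`, `Dic₃` by `decide` and for `Q × A`, `A` abelian, by `Coord.prod`). -/

/-- The label (`< 6`) of an element: `κ` and the sign, i.e. its image in `G/Z(G) ≅ S₃`. [folklore] -/
def lab {α : Type*} (κ ε : α → ZMod 3) (y : α) : ℕ := (κ y).val + if ε y = 1 then 0 else 3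

/-- Labels are `< 6`. [folklore] -/
theorem lab_lt {α : Type*} (κ ε : α → ZMod 3) (y : α) : lab κ ε y < 6 := by
  unfold lab; have := (κ y).val_lt; split_ifs <;> omega

variable {G : Type*} [Group G]

/-- The hypothesis package: `c³ = 1`, a crossed coordinate `κ : G → ZMod 3` (`κ(gh) = κ g + ε(g) κ h`, `κ c = 1`) for a sign
character `ε : G → {±1} ⊆ ZMod 3`, and all commutators in `K = {1, c, c²}`.  Holds exactly for the groups `C₃ ⋊_ε C` with `C`
abelian (`ε` trivial allowed: `C₃ × C`) — in particular for every group whose centre has index `6`. [folklore] -/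
def Coord (c : G) (κ ε : G → ZMod 3) : Prop :=
  c * c * c = 1 ∧ κ c = 1 ∧ (∀ g, ε g = 1 ∨ ε g = -1) ∧ (∀ g k, κ (g * k) = κ g + ε g * κ k) ∧
    (∀ g k, ε (g * k) = ε g * ε k) ∧ ∀ a b : G, ∃ u, (u = 1 ∨ u = c ∨ u = c * c) ∧ a * b = b * a * u

/-- Membership in `K = {1, c, c²}`. [folklore] -/
def InK (c u : G) : Prop := u = 1 ∨ u = c ∨ u = c * c

/-- The TPP word of two cells `P = (x, y, w)`, `P' = (x', y', w')`: `x x'⁻¹ (y y'⁻¹) (w w'⁻¹)`. [folklore] -/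
def E (P P' : G × G × G) : G := P.1 * P'.1⁻¹ * (P.2.1 * P'.2.1⁻¹) * (P.2.2 * P'.2.2⁻¹)

/-- The product `x y w` of a cell (the fibre map: the fibre of `g` is `{P : g⁻¹ · key P ∈ K}`). [folklore] -/
def key (P : G × G × G) : G := P.1 * P.2.1 * P.2.2

namespace Coord

variable {c : G} {κ ε : G → ZMod 3} (h : Coord c κ ε)
include h

/-! ### Algebra in coordinates -/

/-- `c³ = 1`. [folklore] -/ theorem ccc : c * c * c = 1 := h.1
/-- `κ c = 1`. [folklore] -/ theorem kap_c : κ c = 1 := h.2.1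
/-- `ε = ±1`. [folklore] -/ theorem sign (g : G) : ε g = 1 ∨ ε g = -1 := h.2.2.1 g
/-- `κ(gk) = κ g + ε g κ k`. [folklore] -/ theorem kap_mul (g k : G) : κ (g * k) = κ g + ε g * κ k := h.2.2.2.1 g k
/-- `ε(gk) = ε g ε k`. [folklore] -/ theorem eps_mul (g k : G) : ε (g * k) = ε g * ε k := h.2.2.2.2.1 g k
/-- Commutators lie in `K`. [folklore] -/
theorem comm (a b : G) : ∃ u, InK c u ∧ a * b = b * a * u := h.2.2.2.2.2 a b

/-- `ε² = 1`. [folklore] -/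
theorem eps_sq (g : G) : ε g * ε g = 1 := by rcases h.sign g with e | e <;> rw [e] <;> decide

/-- `ε 1 = 1`. [folklore] -/
theorem eps_one : ε 1 = 1 := by
  have e := h.eps_mul 1 1
  rw [mul_one] at e
  rcases h.sign 1 with e1 | e1
  · exact e1
  · rw [e1] at e; exact absurd e (by decide)

/-- `κ 1 = 0`. [folklore] -/
theorem kap_one : κ 1 = 0 := by
  have e := h.kap_mul 1 1
  rw [mul_one, h.eps_one, one_mul] at e
  linear_combination (-1 : ZMod 3) * e

/-- `κ(g⁻¹) = −ε g κ g`. [folklore] -/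
theorem kap_inv (g : G) : κ g⁻¹ = -(ε g * κ g) := by
  have e := h.kap_mul g g⁻¹
  rw [mul_inv_cancel, h.kap_one] at e
  linear_combination (-(ε g)) * e + (-(κ g⁻¹)) * h.eps_sq g

/-- `ε(g⁻¹) = ε g`. [folklore] -/
theorem eps_inv (g : G) : ε g⁻¹ = ε g := by
  have e := h.eps_mul g g⁻¹
  rw [mul_inv_cancel, h.eps_one] at e
  linear_combination (-(ε g)) * e + (-(ε g⁻¹)) * h.eps_sq g

/-- `c ≠ 1`. [folklore] -/
theorem c_ne_one : c ≠ 1 := fun e => by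
  have := h.kap_c; rw [e, h.kap_one] at this; exact zero_ne_one this

/-- `c · c² = 1`. [folklore] -/
theorem c_mul_cc : c * (c * c) = 1 := by rw [← mul_assoc]; exact h.ccc

/-- `c² · c² = c`. [folklore] -/
theorem cc_mul_cc : c * c * (c * c) = c := by rw [← mul_assoc, h.ccc, one_mul]

/-- `ε c = 1` (`c` commutes with itself). [folklore] -/
theorem eps_c : ε c = 1 := by
  rcases h.sign c with e | e
  · exact e
  · exfalso
    have e2 := h.kap_mul c c
    have e3 := h.kap_mul (c * c) c
    rw [h.ccc, h.kap_one, h.eps_mul, h.kap_c, e2, h.kap_c, e] at e3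
    exact absurd e3 (by decide)

/-- `κ(c²) = −1`. [folklore] -/
theorem kap_cc : κ (c * c) = -1 := by rw [h.kap_mul, h.kap_c, h.eps_c]; decide

/-- `c² ≠ 1`. [folklore] -/
theorem cc_ne_one : c * c ≠ 1 := fun e => by
  have := h.kap_cc; rw [e, h.kap_one] at this; exact absurd this (by decide)

/-- `c ≠ c²`. [folklore] -/
theorem c_ne_cc : c ≠ c * c := fun e => by
  have := h.kap_c; rw [e, h.kap_cc] at this; exact absurd this (by decide)

/-- `K` is closed under products. [folklore] -/
theorem inK_mul {u v : G} (hu : InK c u) (hv : InK c v) : InK c (u * v) := by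
  rcases hu with rfl | rfl | rfl <;> rcases hv with rfl | rfl | rfl <;>
    simp only [InK, mul_one, one_mul, h.ccc, h.c_mul_cc, h.cc_mul_cc, true_or, or_true]

/-- `K` is closed under inverses. [folklore] -/
theorem inK_inv {u : G} (hu : InK c u) : InK c u⁻¹ := by
  rcases hu with rfl | rfl | rfl
  · exact Or.inl inv_one
  · exact Or.inr (Or.inr (inv_eq_of_mul_eq_one_right h.c_mul_cc))
  · exact Or.inr (Or.inl (inv_eq_of_mul_eq_one_right h.ccc))

/-- `ε = 1` on `K`. [folklore] -/
theorem inK_eps {u : G} (hu : InK c u) : ε u = 1 := by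
  rcases hu with rfl | rfl | rfl
  · exact h.eps_one
  · exact h.eps_c
  · rw [h.eps_mul, h.eps_c, mul_one]

/-- On `K`, `κ = 0` only at `1`. [folklore] -/
theorem inK_eq_one {u : G} (hu : InK c u) (h0 : κ u = 0) : u = 1 := by
  rcases hu with rfl | rfl | rfl
  · rfl
  · rw [h.kap_c] at h0; exact absurd h0 (by decide)
  · rw [h.kap_cc] at h0; exact absurd h0 (by decide)

/-- `κ` is injective on `K`. [folklore] -/
theorem inK_eq_of_kap {u v : G} (hu : InK c u) (hv : InK c v) (e : κ u = κ v) : u = v := by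
  rcases hu with rfl | rfl | rfl <;> rcases hv with rfl | rfl | rfl <;>
    simp only [h.kap_one, h.kap_c, h.kap_cc] at e <;> first | rfl | exact absurd e (by decide)

/-- `K` moves past any element: `u a = a v` with `v ∈ K`. [folklore] -/
theorem inK_move {u : G} (hu : InK c u) (a : G) : ∃ v, InK c v ∧ u * a = a * v := by
  obtain ⟨w, hw, e⟩ := h.comm u a
  exact ⟨u * w, h.inK_mul hu hw, by rw [e, mul_assoc]⟩

/-- `K` is closed under conjugation. [folklore] -/
theorem inK_conj {u : G} (hu : InK c u) (g : G) : InK c (g * u * g⁻¹) := by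
  obtain ⟨w, hw, e⟩ := h.comm (g * u) g⁻¹
  rw [e, inv_mul_cancel_left]
  exact h.inK_mul hu hw

/-! ### Cell words -/

/-- `key P · (key P')⁻¹ = E(P, P') · u` with `u ∈ K` (two commutators). [folklore] -/
theorem key_mul_inv (P P' : G × G × G) : ∃ u, InK c u ∧ key P * (key P')⁻¹ = E P P' * u := by
  obtain ⟨x, y, w⟩ := P
  obtain ⟨x', y', w'⟩ := P'
  simp only [key, E]
  obtain ⟨v₁, hv₁, e₁⟩ := h.comm (w * w'⁻¹) y'⁻¹
  obtain ⟨v₂, hv₂, e₂⟩ := h.inK_move hv₁ x'⁻¹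
  obtain ⟨v₃, hv₃, e₃⟩ := h.comm (y * y'⁻¹ * (w * w'⁻¹)) x'⁻¹
  refine ⟨v₃ * v₂, h.inK_mul hv₃ hv₂, ?_⟩
  calc x * y * w * (x' * y' * w')⁻¹ = x * y * (w * w'⁻¹ * y'⁻¹) * x'⁻¹ := by group
    _ = x * y * (y'⁻¹ * (w * w'⁻¹) * v₁) * x'⁻¹ := by rw [e₁]
    _ = x * (y * y'⁻¹ * (w * w'⁻¹)) * (v₁ * x'⁻¹) := by group
    _ = x * (y * y'⁻¹ * (w * w'⁻¹)) * (x'⁻¹ * v₂) := by rw [e₂]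
    _ = x * (y * y'⁻¹ * (w * w'⁻¹) * x'⁻¹) * v₂ := by group
    _ = x * (x'⁻¹ * (y * y'⁻¹ * (w * w'⁻¹)) * v₃) * v₂ := by rw [e₃]
    _ = x * x'⁻¹ * (y * y'⁻¹) * (w * w'⁻¹) * (v₃ * v₂) := by group

/-- Two cells of one fibre have their word in `K`. [folklore] -/
theorem inK_E {g : G} {P P' : G × G × G} (hP : InK c (g⁻¹ * key P)) (hP' : InK c (g⁻¹ * key P')) :
    InK c (E P P') := by
  obtain ⟨u₀, hu₀, e₀⟩ := h.key_mul_inv P P'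
  have hk : InK c (key P * (key P')⁻¹) := by
    have : key P * (key P')⁻¹ = g * (g⁻¹ * key P * (g⁻¹ * key P')⁻¹) * g⁻¹ := by group
    rw [this]
    exact h.inK_conj (h.inK_mul hP (h.inK_inv hP')) g
  have : E P P' = key P * (key P')⁻¹ * u₀⁻¹ := by rw [e₀]; group
  rw [this]
  exact h.inK_mul hk (h.inK_inv hu₀)

/-- The `c`-exponent of a word, expanded. [folklore] -/
theorem kap_E (x y w x' y' w' : G) : κ (E (x, y, w) (x', y', w')) =
    κ x - ε x * ε x' * κ x' + ε x * ε x' * (κ y - ε y * ε y' * κ y' + ε y * ε y' * (κ w - ε w * ε w' * κ w')) := by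
  simp only [E, h.kap_mul, h.eps_mul, h.kap_inv, h.eps_inv]; ring

/-- In the fibre of `g`, the sign of the first coordinate is `ε g ε y ε w`. [folklore] -/
theorem eps_of_fibre {g x y w : G} (hu : InK c (g⁻¹ * (x * y * w))) : ε x = ε g * ε y * ε w := by
  have e := h.inK_eps hu
  rw [h.eps_mul, h.eps_mul, h.eps_mul, h.eps_inv] at e
  linear_combination (-(ε x)) * e + (ε g * ε y * ε w) * h.eps_sq x

/-- **The fibre word formula** (M1 of the cell's prereg P-028): with the normalised lift `λ_P = ε_y ε_w κ_x`,
`κ(E(P, P')) = ε_y ε_w (λ_P − λ_{P'} + ε_{y'} ε_{w'} B)`, `B = κ_y − ε_y ε_{y'} κ_{y'} + ε_y ε_{y'} (κ_w − ε_w ε_{w'} κ_{w'})`. [folklore] -/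
theorem kap_E_fibre {g x y w x' y' w' : G} (hu : InK c (g⁻¹ * (x * y * w))) (hu' : InK c (g⁻¹ * (x' * y' * w'))) :
    κ (E (x, y, w) (x', y', w')) = ε y * ε w * (ε y * ε w * κ x - ε y' * ε w' * κ x' +
      ε y' * ε w' * (κ y - ε y * ε y' * κ y' + ε y * ε y' * (κ w - ε w * ε w' * κ w'))) := by
  rw [h.kap_E, h.eps_of_fibre hu, h.eps_of_fibre hu']
  linear_combination (-(κ x * ε w * ε w)) * h.eps_sq y + (-(κ x)) * h.eps_sq w +
    ((κ y - ε y * ε y' * κ y' + ε y * ε y' * (κ w - ε w * ε w' * κ w') - κ x') * ε y * ε w * ε y' * ε w') * h.eps_sq g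

/-- `lab 1 = 0`. [folklore] -/
theorem lab_one : lab κ ε 1 = 0 := by rw [lab, h.kap_one, h.eps_one, ZMod.val_zero, if_pos rfl]

end Coord

end Summit.MatrixMultiplication.OmegaCensus.CentreIndexSix
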